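import Summits.CriticalPhenomena.CardyFormulaZ2.Theorems.CardyIKTransportCornerLineDescentFreezeBlocks2
import Literature.Probability.LatticeModels.IsoradialPercolationProofs

/-!
# The frozen end `p = 0` of the corner line, part 4: frozen-gauge connectivity = bond percolation on the black blocks

Support file (Freeze groundwork, part 4 of 4) for the line `symmetric-seed-second-order` of the crux
`CardyIKTransport.CornerLineDescent` (stmt-CriticalPhenomena-10964), serving the registered stub
`stub_FreezeHomogenisation`.  THE IDENTIFICATION, windowed for crossing events: cells of one black block are connected
inside the block (`connIn_of_blockIdx_eq`: a horizontal run then a vertical run); an open cell path inside a window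
`W` projects to an open block path inside `blockIdx '' W` (`blockConnIn_of_openConnIn`); an open block path inside a
set `S` of blocks, from the block of a black cell, lifts to an open cell path — between ANY cells of the end blocks —
inside any window containing every cell of every block of `S` (`openConnIn_of_blockConnIn`).  Unwindowed corollary
(anchor `frozen_reachable_iff_blockReachable`): from a black cell, open-cluster connectivity of cells in the frozen
gauge is connectivity of their blocks in `openGraph (blockBonds …)`, i.e. bond percolation on the black-block `ℤ²`.
This is the deterministic half of the coupling behind `FreezeHomogenisation`; the probabilistic half (flips a.s.
unbounded, SLLN for the grid, coins i.i.d. given the grid) and the continuity of crude bond-`ℤ²` crossing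
probabilities in the domain are NOT here.  References: route file `Theses/CardyIKTransport.lean` (items 10964,
4967); Grimmett, *Percolation* (1999) §1.3; `Cruxes/CornerLineDescent/Disproof.lean` §F.
-/

noncomputable section

namespace Summit.CriticalPhenomena.CardyFormulaZ2.Theorems.CornerLineDescent.SymmetricSeed

open scoped BigOperators Topology Classical MeasureTheory ProbabilityTheory ENNReal NNReal
open Filter Set Function MeasureTheory
open Literature.Probability.Percolation (sitePercolation bondPercolation half BondConfig embDomainCrossing rectangle)
open Literature.Probability.LatticeModels
open Literature.Probability.RandomPlanarGeometry


namespace Freeze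

/-! ### Connectivity inside a window: cells of a black block are joined; block bonds are corner diagonals -/

open Literature.Probability.Percolation (openGraph openGraph_adj openConnIn)

section ConnIn

variable {V : Type*} {S T : Set V} {x y z : V} {ϖ : BondConfig V}

/-- `{x ↔ x in S}` for `x ∈ S`. [folklore] -/
private theorem connIn_refl (hx : x ∈ S) : ϖ ∈ openConnIn S x x := ⟨hx, hx, SimpleGraph.Reachable.refl _⟩

/-- `openConnIn S` is transitive (cf. `Literature.Probability.Percolation.openConnIn_trans` in `SeedLemma`, not
imported to keep the import closure small). [folklore] -/
private theorem connIn_trans (h1 : ϖ ∈ openConnIn S x y) (h2 : ϖ ∈ openConnIn S y z) : ϖ ∈ openConnIn S x z := by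
  obtain ⟨hx, _, h⟩ := h1; obtain ⟨_, hz, h'⟩ := h2; exact ⟨hx, hz, h.trans h'⟩

/-- `openConnIn S` is symmetric. [folklore] -/
private theorem connIn_symm (h1 : ϖ ∈ openConnIn S x y) : ϖ ∈ openConnIn S y x := by
  obtain ⟨hx, hy, h⟩ := h1; exact ⟨hy, hx, h.symm⟩

/-- An open edge with both endpoints in `S` is an open path inside `S`. [folklore] -/
private theorem connIn_of_adj (hx : x ∈ S) (hy : y ∈ S) (h : (openGraph ϖ).Adj x y) : ϖ ∈ openConnIn S x y :=
  ⟨hx, hy, SimpleGraph.Adj.reachable (show ((openGraph ϖ).induce S).Adj ⟨x, hx⟩ ⟨y, hy⟩ from h)⟩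

/-- `{x ↔ y in univ}` is plain reachability in the open graph. [folklore] -/
theorem openConnIn_univ_iff : ϖ ∈ openConnIn Set.univ x y ↔ (openGraph ϖ).Reachable x y := by
  rw [mem_openConnIn_iff_exists_openWalk]
  exact ⟨fun ⟨w, _⟩ => ⟨w⟩, fun ⟨w⟩ => ⟨w, fun _ _ => Set.mem_univ _⟩⟩

end ConnIn

/-- Horizontal moves inside a run of `A` from a black cell are open, inside any window containing the block. [folklore] -/
theorem connIn_add_horizontal {ω : Bits} (h : ω.2.2.1 = ∅) (eA : FlipEnum ω.1) (eB : FlipEnum ω.2.1)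
    {W : Set (Site 2)} (n : ℕ) : ∀ u : Site 2, gaugeColour ω u → eA.runIdx (u 0 + n) = eA.runIdx (u 0) →
      (∀ z : Site 2, blockIdx eA eB z = blockIdx eA eB u → z ∈ W) →
      gaugeEdges ω ∈ openConnIn W u (u + ![(n : ℤ), 0]) := by
  induction n with
  | zero =>
    intro u _ _ hW
    have : u + ![((0 : ℕ) : ℤ), 0] = u := by ext k; fin_cases k <;> simp
    rw [this]
    exact connIn_refl (hW u rfl)
  | succ n ih =>
    intro u hu hrun hW
    have hmono₁ : eA.runIdx (u 0) ≤ eA.runIdx (u 0 + n) := eA.runIdx_mono (by omega)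
    have hmono₂ : eA.runIdx (u 0 + n) ≤ eA.runIdx (u 0 + (n + 1 : ℕ)) := eA.runIdx_mono (by push_cast; omega)
    have hn : eA.runIdx (u 0 + n) = eA.runIdx (u 0) := le_antisymm (by omega) hmono₁
    have hb₁ : blockIdx eA eB (u + ![(n : ℤ), 0]) = blockIdx eA eB u := by simp [blockIdx, hn]
    have hrun' : eA.runIdx (u 0 + (n + 1)) = eA.runIdx (u 0) := by push_cast at hrun; exact hrun
    have hb₂ : blockIdx eA eB (u + ![((n + 1 : ℕ) : ℤ), 0]) = blockIdx eA eB u := by simp [blockIdx, hrun']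
    refine connIn_trans (ih u hu hn hW) (connIn_of_adj (hW _ hb₁) (hW _ hb₂) ?_)
    rw [openGraph_adj]
    have hp : u + ![((n + 1 : ℕ) : ℤ), 0] = u + ![(n : ℤ), 0] + ![1, 0] := by
      rw [add_assoc]; congr 1; ext k; fin_cases k <;> simp
    refine ⟨?_, ?_⟩
    · rw [hp, mem_gaugeEdges_east_iff_of_empty h]
      refine ⟨(gaugeColour_iff_of_blockParity_eq h eA eB (v := u) (by rw [hb₁]; simp)).2 hu, ?_⟩
      have h1 : eA.runIdx (u 0 + n) = eA.runIdx (u 0 + n + 1) := by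
        rw [hn, ← hrun]; push_cast; ring_nf
      simpa using eA.mem_iff_mem_of_runIdx_eq h1
    · intro heq
      have := congrFun heq 0
      simp at this

/-- Vertical moves inside a run of `B` from a black cell are open, inside any window containing the block. [folklore] -/
theorem connIn_add_vertical {ω : Bits} (h : ω.2.2.1 = ∅) (eA : FlipEnum ω.1) (eB : FlipEnum ω.2.1)
    {W : Set (Site 2)} (n : ℕ) : ∀ u : Site 2, gaugeColour ω u → eB.runIdx (u 1 + n) = eB.runIdx (u 1) →
      (∀ z : Site 2, blockIdx eA eB z = blockIdx eA eB u → z ∈ W) →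
      gaugeEdges ω ∈ openConnIn W u (u + ![0, (n : ℤ)]) := by
  induction n with
  | zero =>
    intro u _ _ hW
    have : u + ![0, ((0 : ℕ) : ℤ)] = u := by ext k; fin_cases k <;> simp
    rw [this]
    exact connIn_refl (hW u rfl)
  | succ n ih =>
    intro u hu hrun hW
    have hmono₁ : eB.runIdx (u 1) ≤ eB.runIdx (u 1 + n) := eB.runIdx_mono (by omega)
    have hmono₂ : eB.runIdx (u 1 + n) ≤ eB.runIdx (u 1 + (n + 1 : ℕ)) := eB.runIdx_mono (by push_cast; omega)
    have hn : eB.runIdx (u 1 + n) = eB.runIdx (u 1) := le_antisymm (by omega) hmono₁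
    have hb₁ : blockIdx eA eB (u + ![0, (n : ℤ)]) = blockIdx eA eB u := by simp [blockIdx, hn]
    have hrun' : eB.runIdx (u 1 + (n + 1)) = eB.runIdx (u 1) := by push_cast at hrun; exact hrun
    have hb₂ : blockIdx eA eB (u + ![0, ((n + 1 : ℕ) : ℤ)]) = blockIdx eA eB u := by simp [blockIdx, hrun']
    refine connIn_trans (ih u hu hn hW) (connIn_of_adj (hW _ hb₁) (hW _ hb₂) ?_)
    rw [openGraph_adj]
    have hp : u + ![0, ((n + 1 : ℕ) : ℤ)] = u + ![0, (n : ℤ)] + ![0, 1] := by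
      rw [add_assoc]; congr 1; ext k; fin_cases k <;> simp
    refine ⟨?_, ?_⟩
    · rw [hp, mem_gaugeEdges_north_iff_of_empty h]
      refine ⟨(gaugeColour_iff_of_blockParity_eq h eA eB (v := u) (by rw [hb₁]; simp)).2 hu, ?_⟩
      have h1 : eB.runIdx (u 1 + n) = eB.runIdx (u 1 + n + 1) := by
        rw [hn, ← hrun]; push_cast; ring_nf
      simpa using eB.mem_iff_mem_of_runIdx_eq h1
    · intro heq
      have := congrFun heq 1
      simp at this

/-- CELLS OF ONE BLACK BLOCK ARE CONNECTED INSIDE THE BLOCK (horizontal run, then vertical run), hence inside any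
window `W` containing the block. [folklore] -/
theorem connIn_of_blockIdx_eq {ω : Bits} (h : ω.2.2.1 = ∅) (eA : FlipEnum ω.1) (eB : FlipEnum ω.2.1)
    {W : Set (Site 2)} {u v : Site 2} (hu : gaugeColour ω u) (hb : blockIdx eA eB u = blockIdx eA eB v)
    (hW : ∀ z : Site 2, blockIdx eA eB z = blockIdx eA eB u → z ∈ W) :
    gaugeEdges ω ∈ openConnIn W u v := by
  have hv : gaugeColour ω v := (gaugeColour_iff_of_blockParity_eq h eA eB (u := v) (v := u) (by simp [hb])).2 hu
  have hb' := hb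
  simp only [blockIdx, Prod.mk.injEq] at hb
  -- the intermediate cell `w = (v0, u1)` is in the same block
  set w : Site 2 := ![v 0, u 1] with hw
  have hw0 : w 0 = v 0 := by simp [hw]
  have hw1 : w 1 = u 1 := by simp [hw]
  have hbw : blockIdx eA eB w = blockIdx eA eB u := by simp [blockIdx, hw0, hw1, hb.1]
  have hwc : gaugeColour ω w := (gaugeColour_iff_of_blockParity_eq h eA eB (u := w) (v := u) (by simp [hbw])).2 hu
  have hWw : ∀ z : Site 2, blockIdx eA eB z = blockIdx eA eB w → z ∈ W := fun z hz => hW z (hz.trans hbw)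
  have hWv : ∀ z : Site 2, blockIdx eA eB z = blockIdx eA eB v → z ∈ W := fun z hz => hW z (hz.trans hb'.symm)
  have huw : gaugeEdges ω ∈ openConnIn W u w := by
    rcases le_total (u 0) (v 0) with hle | hle
    · have key := connIn_add_horizontal h eA eB (v 0 - u 0).toNat u hu
        (by rw [Int.toNat_of_nonneg (by omega), add_sub_cancel, hb.1]) hW
      have : u + ![((v 0 - u 0).toNat : ℤ), 0] = w := by
        rw [Int.toNat_of_nonneg (by omega)]; ext k; fin_cases k <;> simp [hw]
      rwa [this] at key
    · have key := connIn_add_horizontal h eA eB (u 0 - v 0).toNat w hwc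
        (by rw [Int.toNat_of_nonneg (by omega), hw0, add_sub_cancel, hb.1]) hWw
      have : w + ![((u 0 - v 0).toNat : ℤ), 0] = u := by
        rw [Int.toNat_of_nonneg (by omega)]; ext k; fin_cases k <;> simp [hw]
      rw [this] at key
      exact connIn_symm key
  have hwv : gaugeEdges ω ∈ openConnIn W w v := by
    rcases le_total (u 1) (v 1) with hle | hle
    · have key := connIn_add_vertical h eA eB (v 1 - u 1).toNat w hwc
        (by rw [Int.toNat_of_nonneg (by omega), hw1, add_sub_cancel, ← hb.2]) hWw
      have : w + ![0, ((v 1 - u 1).toNat : ℤ)] = v := by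
        rw [Int.toNat_of_nonneg (by omega)]; ext k; fin_cases k <;> simp [hw]
      rwa [this] at key
    · have key := connIn_add_vertical h eA eB (u 1 - v 1).toNat v hv
        (by rw [Int.toNat_of_nonneg (by omega), add_sub_cancel, hb.2]) hWv
      have : v + ![0, ((u 1 - v 1).toNat : ℤ)] = w := by
        rw [Int.toNat_of_nonneg (by omega)]; ext k; fin_cases k <;> simp [hw]
      rw [this] at key
      exact connIn_symm key
  exact connIn_trans huw hwv

/-- Cells of one black block are connected (window `univ`). [folklore] -/
theorem reachable_of_blockIdx_eq {ω : Bits} (h : ω.2.2.1 = ∅) (eA : FlipEnum ω.1) (eB : FlipEnum ω.2.1)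
    {u v : Site 2} (hu : gaugeColour ω u) (hb : blockIdx eA eB u = blockIdx eA eB v) :
    (openGraph (gaugeEdges ω)).Reachable u v :=
  openConnIn_univ_iff.1 (connIn_of_blockIdx_eq h eA eB hu hb fun _ _ => Set.mem_univ _)

/-- THE FROZEN GAUGE IS BOND PERCOLATION ON THE BLACK BLOCKS, (⇒), WINDOWED: an open path of cells inside the window
`W` projects to an open path of blocks inside the set of blocks meeting `W`. [folklore] -/
theorem blockConnIn_of_openConnIn {ω : Bits} (h : ω.2.2.1 = ∅) (eA : FlipEnum ω.1) (eB : FlipEnum ω.2.1)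
    {W : Set (Site 2)} {u v : Site 2} (hc : gaugeEdges ω ∈ openConnIn W u v) :
    blockBonds ω eA eB ∈ openConnIn (blockIdx eA eB '' W) (blockIdx eA eB u) (blockIdx eA eB v) := by
  rw [mem_openConnIn_iff_exists_openWalk] at hc
  obtain ⟨w, hw⟩ := hc
  induction w with
  | nil => exact connIn_refl (Set.mem_image_of_mem _ (hw _ (SimpleGraph.Walk.start_mem_support _)))
  | cons hadj p ih =>
    rename_i a b _
    have ha : a ∈ W := hw _ (SimpleGraph.Walk.start_mem_support _)
    have hp : ∀ z ∈ p.support, z ∈ W := fun z hz => hw z (by simp [hz])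
    have hb : b ∈ W := hp _ (SimpleGraph.Walk.start_mem_support _)
    refine connIn_trans ?_ (ih hp)
    rw [openGraph_adj] at hadj
    rcases blockStep_of_mem_gaugeEdges h eA eB hadj.1 with h1 | h1
    · rw [h1]; exact connIn_refl (Set.mem_image_of_mem _ hb)
    · exact connIn_of_adj (Set.mem_image_of_mem _ ha) (Set.mem_image_of_mem _ hb)
        ((openGraph_adj _ _ _).2 ⟨h1, ne_of_mem_blockBonds h1⟩)

/-- THE FROZEN GAUGE IS BOND PERCOLATION ON THE BLACK BLOCKS, (⇐), WINDOWED: an open path of blocks inside `S`,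
starting at the block of a black cell, lifts to an open path of cells — between ANY cells of the end blocks — inside
any window `W` containing every cell of every block of `S`. [folklore] -/
theorem openConnIn_of_blockConnIn {ω : Bits} (h : ω.2.2.1 = ∅) (eA : FlipEnum ω.1) (eB : FlipEnum ω.2.1)
    {W : Set (Site 2)} {S : Set (ℤ × ℤ)} (hS : ∀ z : Site 2, blockIdx eA eB z ∈ S → z ∈ W)
    {u v : Site 2} (hu : gaugeColour ω u)
    (hc : blockBonds ω eA eB ∈ openConnIn S (blockIdx eA eB u) (blockIdx eA eB v)) :
    gaugeEdges ω ∈ openConnIn W u v := by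
  rw [mem_openConnIn_iff_exists_openWalk] at hc
  obtain ⟨p, hp⟩ := hc
  suffices key : ∀ (a c : ℤ × ℤ) (p : (openGraph (blockBonds ω eA eB)).Walk a c), (∀ b ∈ p.support, b ∈ S) →
      ∀ u : Site 2, gaugeColour ω u → blockIdx eA eB u = a → blockIdx eA eB v = c →
        gaugeEdges ω ∈ openConnIn W u v from key _ _ p hp u hu rfl rfl
  intro a c p
  induction p with
  | nil =>
    rename_i a
    intro hp u hu ha hv
    have haS : a ∈ S := hp _ (SimpleGraph.Walk.start_mem_support _)
    exact connIn_of_blockIdx_eq h eA eB hu (ha.trans hv.symm) fun z hz => hS z (by rw [hz, ha]; exact haS)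
  | cons hadj p ih =>
    rename_i a b _
    intro hp u hu ha hv
    have haS : a ∈ S := hp _ (SimpleGraph.Walk.start_mem_support _)
    have hpS : ∀ z ∈ p.support, z ∈ S := fun z hz => hp z (by simp [hz])
    have hbS : b ∈ S := hpS _ (SimpleGraph.Walk.start_mem_support _)
    rw [openGraph_adj] at hadj
    obtain ⟨x, y, hx, hy, hxy⟩ := exists_adj_of_mem_blockBonds h eA eB hu ha hadj.1
    have hux : gaugeEdges ω ∈ openConnIn W u x :=
      connIn_of_blockIdx_eq h eA eB hu (ha.trans hx.symm) fun z hz => hS z (by rw [hz, ha]; exact haS)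
    have hxyW : gaugeEdges ω ∈ openConnIn W x y :=
      connIn_of_adj (hS x (by rw [hx]; exact haS)) (hS y (by rw [hy]; exact hbS)) hxy
    -- `y` is black: the edge `s(x, y)` has black endpoints
    have hyc : gaugeColour ω y := by
      have hmem := ((openGraph_adj _ _ _).1 hxy).1
      rcases (mem_gaugeEdges_iff ω x y).1 hmem with ⟨-, hy', -⟩ | ⟨hy', -, -⟩ <;> exact hy'
    exact connIn_trans hux (connIn_trans hxyW (ih hpS y hyc hy hv))

/-- Unwindowed form, (⇒): open-cluster connectivity of cells projects to the block graph. [folklore] -/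
theorem blockReachable_of_reachable {ω : Bits} (h : ω.2.2.1 = ∅) (eA : FlipEnum ω.1) (eB : FlipEnum ω.2.1)
    {u v : Site 2} (hr : (openGraph (gaugeEdges ω)).Reachable u v) :
    (openGraph (blockBonds ω eA eB)).Reachable (blockIdx eA eB u) (blockIdx eA eB v) := by
  have key := blockConnIn_of_openConnIn h eA eB (W := Set.univ) (openConnIn_univ_iff.2 hr)
  rw [mem_openConnIn_iff_exists_openWalk] at key
  obtain ⟨w, -⟩ := key
  exact ⟨w⟩

/-- Unwindowed form, (⇐): block connectivity from the block of a black cell lifts to the cells. [folklore] -/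
theorem reachable_of_blockReachable {ω : Bits} (h : ω.2.2.1 = ∅) (eA : FlipEnum ω.1) (eB : FlipEnum ω.2.1)
    {u v : Site 2} (hu : gaugeColour ω u)
    (hr : (openGraph (blockBonds ω eA eB)).Reachable (blockIdx eA eB u) (blockIdx eA eB v)) :
    (openGraph (gaugeEdges ω)).Reachable u v :=
  openConnIn_univ_iff.1 (openConnIn_of_blockConnIn h eA eB (S := Set.univ) (fun _ _ => Set.mem_univ _) hu
    (openConnIn_univ_iff.2 hr))

end Freeze

/-- ANCHOR OF PART 4 (registered sub-goal). THE FROZEN GAUGE IS BOND PERCOLATION ON THE BLACK BLOCKS (unwindowed form):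
with no syndromes, for a black cell `u` and any cell `v`, `u ↔ v` in the open cell graph `gaugeEdges ω` iff the blocks
of `u`, `v` are connected in the open block graph `blockBonds ω eA eB`. [folklore] -/
theorem frozen_reachable_iff_blockReachable : ∀ (ω : Bits), ω.2.2.1 = ∅ → ∀ (eA : Freeze.FlipEnum ω.1) (eB : Freeze.FlipEnum ω.2.1) (u v : Site 2), gaugeColour ω u → ((Literature.Probability.Percolation.openGraph (gaugeEdges ω)).Reachable u v ↔ (Literature.Probability.Percolation.openGraph (Freeze.blockBonds ω eA eB)).Reachable (Freeze.blockIdx eA eB u) (Freeze.blockIdx eA eB v)) :=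
  fun _ h eA eB _ _ hu => ⟨Freeze.blockReachable_of_reachable h eA eB, Freeze.reachable_of_blockReachable h eA eB hu⟩

end Summit.CriticalPhenomena.CardyFormulaZ2.Theorems.CornerLineDescent.SymmetricSeed
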